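import Literature.Barriers.ValiantsHypothesis.BILPS19TwistedReedSolomon
import Literature.Barriers.ValiantsHypothesis.BILPS19HMinRank1ToHQuadProofs
import Literature.Computability.Complexity.KnapsackPartition
import Literature.Computability.Complexity.OneInThreeSubsetSumMachine
import Literature.Computability.Complexity.CodeFPStrings
import HarnessLib

/-!
# Bläser–Ikenmeyer–Lysikov–Pandey–Schreyer 2019, Thm 36: `HMinRank` is NP-hard for `n × (2n+1) × (2n+1)`
# tensors and `r = n + 1` — proofs

Sibling proof file of `BILPS19MembershipHardness.lean` (val-lit X5, §8). Discharges the named fact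
`BILPS2019_thm36 F : IsNPHard (hmrLanguageShape36 F)` ("Let `F` be a field of characteristic `0` and
`K` be an effective subfield of `F`. Then `HMinRank_{K,F}` is NP-hard for `n × (2n+1) × (2n+1)`
tensors and `r = n + 1`", arXiv:1911.02534 p0034:L1–L3) for every field `F` of characteristic `0`.

DEVIATION FROM PRINT (disclosed; val-lit lead-np RULING (77)). The printed proof (p0034:L4–L36)
reduces from a Partition variant via the KERNEL of a bordered Vandermonde matrix `A`
([Vardy97]/Khachiyan-type minors) and a kernel basis computed in polynomial time; it has the print
gap recorded as lit erratum B38 (the integers must be pairwise distinct). This file proves the SAME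
STATEMENT by a DIFFERENT reduction — from SUBSET SUM (the tree's `KNAPSACK`, NP-hard by
`KNAPSACK_isNPHard`) via a twisted Reed–Solomon GENERATOR pencil — whose algebra core is the sibling
`BILPS19TwistedReedSolomon.lean`; no kernel basis and no elimination are needed, and distinctness of
the evaluation points holds by construction:

* §I (the instance, `BILPS19Thm36.inst36`): for a SUBSET SUM instance `(l, b)` let
  `w = (w_0, …, w_{m−1})` be the nonzero weights, `B = 4^{m+1}`, `C = Σ_{t<m} 4^t`, `c = b B + C`.
  The `2m + 2` evaluation points are `p_t = w_t B + 4^t`, `q_t = 4^t` (`t < m`) and two dummies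
  `D + 1, D + 2` with `D = B (Σ w + b + 1)` (pairwise distinct naturals, `BILPS19Thm36.point_injOn`);
  the output is the `HMinRank` instance with `k = m + 1` diagonal slices of size
  `N = 2m + 3 = 2k + 1`, slice `a` being `diag(x_0^a, …, x_{2m+1}^a, g_a)` with the twist
  `g_m = −c`, `g_{m−1} = −1`, and the bound `r = m + 2 = k + 1` — exactly the shape of Thm 36.
* §II (digits): an `m`-set `R` of points has `Σ_R x = c` iff it avoids the dummies and picks, in base
  `B`, weights summing to `b` (`BILPS19Thm36.exists_finset_of_subset_points`,
  `BILPS19Thm36.exists_subset_points_of_finset`), i.e. iff `(l, b)` is a yes-instance of SUBSET SUM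
  (`BILPS19Thm36.mem_knapsackSet_iff_exists_finset`, via the masks `Knapsack.maskSum`).
* §III (the pencil): `Σ_a y_a slice_a = diag(p_y(x_0), …, p_y(x_{2m+1}), τ(y))`
  (`BILPS19Thm36.contract3_entries36`), its rank is the weight of the twisted Reed–Solomon word
  (`BILPS19Thm36.rank_contract3_entries36`), and the sibling's `exists_subset_of_weight_le` /
  `weight_of_subset` give `BILPS19Thm36.mem_knapsackSet_iff_inst36_mem` (characteristic `0` is used
  only to keep the natural-number points distinct in `F`).
* §IV (the machine): `BILPS19Thm36.inst36FP` in the typed `CodeFP` algebra (`filter`, `natPow` with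
  unary exponents capped by `unOfNatMin`, `natSum`, `rawGetD`, `intOfNat`/`intNeg`/`smOfInt`, the
  entry table under the unary budget `(2m+3)³ ≥ k N²`).
* §V: `BILPS19Thm36.KNAPSACK_karpReducible_hmrLanguageShape36` (via the generic
  `BILPS19Thm34.karpReducible_of_decoder` and the tree's decoder `Knapsack.decK`), and
  **`BILPS2019_thm36_holds`**.

Theorem-only file (its `def`s are proof plumbing: the instance map and its tables; no statement of
`BILPS19MembershipHardness.lean` is touched, no new fact). HONEST FRAMING (val-lit): typed
literature; `VP ≠ VNP` is NOT proved and nothing here is progress on it.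

## References

* [BlaserIkenmeyerLysikovPandeySchreyer2019] M. Bläser, C. Ikenmeyer, V. Lysikov, A. Pandey,
  F.-O. Schreyer, *Variety membership testing, algebraic natural proofs, and geometric complexity
  theory*, arXiv:1911.02534, §8.2, Problem 2 and Thm. 36 (p0022:L30, p0034:L1–L36).
* [Karp1972] R. M. Karp, *Reducibility among combinatorial problems*, 1972, §3, problem 18
  (KNAPSACK = SUBSET SUM).
* [AroraBarak2009] S. Arora, B. Barak, *Computational Complexity: A Modern Approach*, CUP 2009,
  Def. 2.7, §1.3, §0.1.
-/

noncomputable section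

namespace Literature.Barriers.ValiantsHypothesis

open Literature.Computability.AlgebraicComplexity Literature.Computability.Complexity
open _root_.Computability
open scoped Literature.Computability.Complexity.Notation

universe u

namespace BILPS19Thm36

open CodeFP Brick Finset Polynomial

/-! ### §I. The instance -/

section Instance

/-- The nonzero weights of a SUBSET SUM instance (zero weights never change subset sums).
[cite: Karp1972, §3 problem 18] -/
def wts (l : List ℕ) : List ℕ := l.filter fun a => !decide (a = 0)

/-- `m` = the number of nonzero weights. [cite: BlaserIkenmeyerLysikovPandeySchreyer2019, Thm. 36 (proof)] -/
abbrev mOf (l : List ℕ) : ℕ := (wts l).length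

/-- The base `B = 4^{m+1}` separating the weight digits from the label digits. [cite: BlaserIkenmeyerLysikovPandeySchreyer2019, Thm. 36 (proof)] -/
def baseB (l : List ℕ) : ℕ := 4 ^ (mOf l + 1)

/-- The label sum `C = Σ_{t<m} 4^t`. [cite: BlaserIkenmeyerLysikovPandeySchreyer2019, Thm. 36 (proof)] -/
def labelSum (m : ℕ) : ℕ := ((List.range m).map fun t => 4 ^ t).sum

/-- The prescribed sum `c = b B + C`. [cite: BlaserIkenmeyerLysikovPandeySchreyer2019, Thm. 36 (proof)] -/
def target (l : List ℕ) (b : ℕ) : ℕ := b * baseB l + labelSum (mOf l)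

/-- A bound `D = B (Σ w + b + 1)` above every non-dummy point and above `c`. [cite: BlaserIkenmeyerLysikovPandeySchreyer2019, Thm. 36 (proof)] -/
def bigD (l : List ℕ) (b : ℕ) : ℕ := baseB l * ((wts l).sum + b + 1)

/-- **The evaluation points** (`ℕ`-indexed): `p_t = w_t B + 4^t` for `t < m`, `q_t = 4^t` at index
`m + t`, and the dummies `D + 1`, `D + 2` at indices `2m`, `2m + 1` (and beyond). (Conditions are
written on `Bool` so that the `CodeFP` machine of §IV computes these tables up to `rfl`.)
[cite: BlaserIkenmeyerLysikovPandeySchreyer2019, Thm. 36 (proof)] -/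
def point (l : List ℕ) (b i : ℕ) : ℕ :=
  if decide (i < mOf l) then (wts l).getD i 0 * baseB l + 4 ^ i
  else if decide (i < 2 * mOf l) then 4 ^ (i - mOf l)
  else bigD l b + (i - 2 * mOf l) + 1

/-- **The twist coefficients** `g_m = −c`, `g_{m−1} = −1`, `g_a = 0` otherwise.
[cite: BlaserIkenmeyerLysikovPandeySchreyer2019, Thm. 36 (proof)] -/
def twist (l : List ℕ) (b a : ℕ) : ℤ :=
  if decide (a = mOf l) then -(target l b : ℤ) else if decide (a + 1 = mOf l) then -1 else 0

/-- The diagonal of slice `a`: `x_R^a` at the `2m + 2` point positions, `g_a` at the last position.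
[cite: BlaserIkenmeyerLysikovPandeySchreyer2019, Thm. 36 (proof)] -/
def diagEntry (l : List ℕ) (b a R : ℕ) : ℤ :=
  if decide (R < 2 * mOf l + 2) then ((point l b R ^ a : ℕ) : ℤ) else twist l b a

/-- Entry `(R, C)` of slice `a` (diagonal slices). [cite: BlaserIkenmeyerLysikovPandeySchreyer2019, Thm. 36 (proof)] -/
def sliceEntry36 (l : List ℕ) (b a R C : ℕ) : ℤ := if decide (R = C) then diagEntry l b a R else 0

/-- The slice size `N = 2m + 3`. [cite: BlaserIkenmeyerLysikovPandeySchreyer2019, Thm. 36] -/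
abbrev dimN (l : List ℕ) : ℕ := 2 * mOf l + 2 + 1

/-- The entry list: `m + 1` slices of size `N × N`, slice-major then row-major (the input format of
`HMinRank`, `hmrTensorOfList`). [cite: BlaserIkenmeyerLysikovPandeySchreyer2019, Problem 2 (input)] -/
def entries36 (l : List ℕ) (b : ℕ) : List ℤ :=
  (List.range ((mOf l + 1) * dimN l ^ 2)).map fun s =>
    sliceEntry36 l b (s / dimN l ^ 2) (s / dimN l % dimN l) (s % dimN l)

/-- **The `HMinRank` instance of a SUBSET SUM instance**: `(N, k, entries, r) = (2m+3, m+1, _, m+2)`.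
[cite: BlaserIkenmeyerLysikovPandeySchreyer2019, Thm. 36 (proof)] -/
def inst36 (x : List ℕ × ℕ) : ℕ × ℕ × List ℤ × ℕ := (dimN x.1, mOf x.1 + 1, entries36 x.1 x.2, mOf x.1 + 2)

/-- The fixed non-member (`0 ≠ 2·0 + 1`). [cite: BlaserIkenmeyerLysikovPandeySchreyer2019, Thm. 36] -/
def bad36 : ℕ × ℕ × List ℤ × ℕ := (0, 0, [], 0)

end Instance

/-! ### §II. Digits: `m`-subsets of the points with sum `c` ↔ subset sums -/

section Digits

/-- Nonzero weights are weights, and nonzero. [folklore] -/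
private theorem mem_wts {l : List ℕ} {a : ℕ} : a ∈ wts l ↔ a ∈ l ∧ a ≠ 0 := by
  simp [wts, List.mem_filter]

/-- The `t`-th nonzero weight is nonzero. [folklore] -/
private theorem getD_wts_ne_zero {l : List ℕ} {t : ℕ} (ht : t < mOf l) : (wts l).getD t 0 ≠ 0 := by
  rw [List.getD_eq_getElem _ _ ht]
  exact (mem_wts.1 (List.getElem_mem ht)).2

/-- A nonzero weight is at most the total. [folklore] -/
private theorem getD_wts_le_sum (l : List ℕ) (t : ℕ) : (wts l).getD t 0 ≤ (wts l).sum := by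
  by_cases ht : t < (wts l).length
  · rw [List.getD_eq_getElem _ _ ht]
    exact List.le_sum_of_mem (List.getElem_mem ht)
  · rw [List.getD_eq_default _ _ (not_lt.1 ht)]; exact Nat.zero_le _

/-- `C = Σ_{t<m} 4^t` as a `Finset` sum. [folklore] -/
private theorem labelSum_eq (m : ℕ) : labelSum m = ∑ t ∈ range m, 4 ^ t := by
  induction m with
  | zero => simp [labelSum]
  | succ m ih =>
    rw [Finset.sum_range_succ, ← ih]
    simp [labelSum, List.range_succ]

/-- `2 C < B`: the labels of all `2m` non-dummy points fit below the base. [folklore] -/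
private theorem two_mul_labelSum_lt (m : ℕ) : 2 * labelSum m < 4 ^ (m + 1) := by
  induction m with
  | zero => simp [labelSum]
  | succ m ih =>
    rw [labelSum_eq, Finset.sum_range_succ, ← labelSum_eq, mul_add, pow_succ]
    have : 0 < 4 ^ (m + 1) := by positivity
    rw [pow_succ] at this ⊢
    omega

/-- The target lies below `D + 1`. [folklore] -/
private theorem target_lt_bigD (l : List ℕ) (b : ℕ) : target l b < bigD l b + 1 := by
  have hC : labelSum (mOf l) < baseB l := by
    have := two_mul_labelSum_lt (mOf l); rw [baseB]; omega
  rw [target, bigD]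
  have : b * baseB l + labelSum (mOf l) < baseB l * (b + 1) := by rw [mul_add, mul_one, mul_comm]; omega
  calc b * baseB l + labelSum (mOf l) < baseB l * (b + 1) := this
    _ ≤ baseB l * ((wts l).sum + b + 1) := Nat.mul_le_mul_left _ (by omega)
    _ < _ := Nat.lt_succ_self _

/-- A `p`-point: `B ≤ p_t < D + 1`. [folklore] -/
private theorem point_lt_of_lt {l : List ℕ} (b : ℕ) {t : ℕ} (ht : t < mOf l) :
    point l b t = (wts l).getD t 0 * baseB l + 4 ^ t ∧ baseB l ≤ point l b t ∧ point l b t < bigD l b + 1 := by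
  have hp : point l b t = (wts l).getD t 0 * baseB l + 4 ^ t := by simp [point, ht]
  refine ⟨hp, ?_, ?_⟩
  · rw [hp]
    have h1 : 1 ≤ (wts l).getD t 0 := Nat.one_le_iff_ne_zero.2 (getD_wts_ne_zero ht)
    calc baseB l = 1 * baseB l := (one_mul _).symm
      _ ≤ (wts l).getD t 0 * baseB l := Nat.mul_le_mul_right _ h1
      _ ≤ _ := Nat.le_add_right _ _
  · rw [hp, bigD]
    have h4 : 4 ^ t < baseB l := by
      rw [baseB]; exact Nat.pow_lt_pow_right (by norm_num) (by omega)
    have hw := getD_wts_le_sum l t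
    calc (wts l).getD t 0 * baseB l + 4 ^ t < (wts l).sum * baseB l + baseB l :=
          add_lt_add_of_le_of_lt (Nat.mul_le_mul_right _ hw) h4
      _ = baseB l * ((wts l).sum + 1) := by ring
      _ ≤ baseB l * ((wts l).sum + b + 1) := Nat.mul_le_mul_left _ (by omega)
      _ < _ := Nat.lt_succ_self _

/-- A `q`-point: `q_t = 4^t < B`. [folklore] -/
private theorem point_mid {l : List ℕ} (b : ℕ) {i : ℕ} (h1 : mOf l ≤ i) (h2 : i < 2 * mOf l) :
    point l b i = 4 ^ (i - mOf l) ∧ point l b i < baseB l := by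
  have hp : point l b i = 4 ^ (i - mOf l) := by simp [point, not_lt.2 h1, h2]
  refine ⟨hp, ?_⟩
  rw [hp, baseB]
  exact Nat.pow_lt_pow_right (by norm_num) (by omega)

/-- A dummy point: `D + 1 + (i − 2m)`. [folklore] -/
private theorem point_high {l : List ℕ} (b : ℕ) {i : ℕ} (h : 2 * mOf l ≤ i) :
    point l b i = bigD l b + (i - 2 * mOf l) + 1 := by
  simp [point, not_lt.2 h, not_lt.2 ((Nat.le_of_lt_succ (Nat.lt_succ_of_le (le_trans (by omega) h))) : mOf l ≤ i)]

/-- `B ≤ D + 1`. [folklore] -/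
private theorem baseB_le_bigD (l : List ℕ) (b : ℕ) : baseB l < bigD l b + 1 := by
  rw [bigD]
  calc baseB l = baseB l * 1 := (mul_one _).symm
    _ ≤ baseB l * ((wts l).sum + b + 1) := Nat.mul_le_mul_left _ (by omega)
    _ < _ := Nat.lt_succ_self _

/-- **The `2m + 2` points are pairwise distinct.** [cite: BlaserIkenmeyerLysikovPandeySchreyer2019, Thm. 36 (proof: Vandermonde)] -/
theorem point_injOn (l : List ℕ) (b : ℕ) {i j : ℕ} (hi : i < 2 * mOf l + 2) (hj : j < 2 * mOf l + 2)
    (h : point l b i = point l b j) : i = j := by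
  have h4 : ∀ {s t : ℕ}, 4 ^ s = 4 ^ t → s = t := fun h => Nat.pow_right_injective (by norm_num : 2 ≤ 4) h
  have hB : ∀ {t : ℕ}, t < mOf l → ((wts l).getD t 0 * baseB l + 4 ^ t) % baseB l = 4 ^ t := fun {t} ht => by
    rw [Nat.mul_add_mod_of_lt]
    rw [baseB]; exact Nat.pow_lt_pow_right (by norm_num) (by omega)
  -- case analysis on the three blocks
  rcases lt_or_ge i (mOf l) with hi1 | hi1 <;> rcases lt_or_ge j (mOf l) with hj1 | hj1
  · obtain ⟨ei, -, -⟩ := point_lt_of_lt b hi1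
    obtain ⟨ej, -, -⟩ := point_lt_of_lt b hj1
    rw [ei, ej] at h
    have := congrArg (· % baseB l) h
    simp only [hB hi1, hB hj1] at this
    exact h4 this
  · exfalso
    obtain ⟨-, hBi, hDi⟩ := point_lt_of_lt b hi1
    rcases lt_or_ge j (2 * mOf l) with hj2 | hj2
    · obtain ⟨-, hlt⟩ := point_mid b hj1 hj2
      omega
    · rw [point_high b hj2] at h
      omega
  · exfalso
    obtain ⟨-, hBj, hDj⟩ := point_lt_of_lt b hj1
    rcases lt_or_ge i (2 * mOf l) with hi2 | hi2
    · obtain ⟨-, hlt⟩ := point_mid b hi1 hi2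
      omega
    · rw [point_high b hi2] at h
      omega
  · rcases lt_or_ge i (2 * mOf l) with hi2 | hi2 <;> rcases lt_or_ge j (2 * mOf l) with hj2 | hj2
    · obtain ⟨ei, -⟩ := point_mid b hi1 hi2
      obtain ⟨ej, -⟩ := point_mid b hj1 hj2
      rw [ei, ej] at h
      have := h4 h
      omega
    · exfalso
      obtain ⟨-, hlt⟩ := point_mid b hi1 hi2
      rw [point_high b hj2] at h
      have := baseB_le_bigD l b
      omega
    · exfalso
      obtain ⟨-, hlt⟩ := point_mid b hj1 hj2
      rw [point_high b hi2] at h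
      have := baseB_le_bigD l b
      omega
    · rw [point_high b hi2, point_high b hj2] at h
      omega

/-! #### Masks and index sets -/

/-- The masked sum as a sum over indices. [folklore] -/
private theorem maskSum_eq_sum : ∀ (μ : List Bool) (w : List ℕ), μ.length = w.length →
    Knapsack.maskSum μ w = ∑ t : Fin w.length, if μ.getD t false then w.getD t 0 else 0
  | [], [], _ => by simp
  | [], _ :: _, h => by simp at h
  | _ :: _, [], h => by simp at h
  | β :: μ, a :: w, h => by
    rw [Knapsack.maskSum_cons_cons, maskSum_eq_sum μ w (by simpa using h), List.length_cons,
      Fin.sum_univ_succ]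
    simp only [Fin.val_zero, List.getD_cons_zero, Fin.val_succ, List.getD_cons_succ]
    cases β <;> simp

/-- Zero weights do not change sublist sums: sums over sublists of `l` are sums over sublists of
its nonzero weights. [cite: Karp1972, §3 problem 18] -/
theorem mem_knapsackSet_iff_wts (l : List ℕ) (b : ℕ) : (l, b) ∈ knapsackSet ↔ (wts l, b) ∈ knapsackSet := by
  have hsum : ∀ l' : List ℕ, (l'.filter fun a => !decide (a = 0)).sum = l'.sum := by
    intro l'
    induction l' with
    | nil => rfl
    | cons a l ih =>
      rw [List.filter_cons]
      by_cases ha : a = 0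
      · subst ha; simpa using ih
      · simp [ha, ih]
  constructor
  · rintro ⟨l', hl', hs⟩
    exact ⟨l'.filter fun a => !decide (a = 0), hl'.filter _, by rw [hsum, hs]⟩
  · rintro ⟨l', hl', hs⟩
    exact ⟨l', hl'.trans List.filter_sublist, hs⟩

/-- **SUBSET SUM by index sets**: `(l, b)` is a yes-instance iff some set of (indices of) nonzero
weights sums to `b`. [cite: Karp1972, §3 problem 18] -/
theorem mem_knapsackSet_iff_exists_finset (l : List ℕ) (b : ℕ) :
    (l, b) ∈ knapsackSet ↔ ∃ S : Finset (Fin (mOf l)), ∑ t ∈ S, (wts l).getD t.1 0 = b := by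
  classical
  rw [mem_knapsackSet_iff_wts]
  constructor
  · rintro ⟨l', hl', hs⟩
    dsimp only at hl' hs
    obtain ⟨μ, hμ, hmask⟩ := Knapsack.exists_mask_of_sublist hl'
    refine ⟨univ.filter fun t : Fin (mOf l) => μ.getD t.1 false = true, ?_⟩
    rw [Finset.sum_filter, ← hs, ← hmask, maskSum_eq_sum μ _ hμ]
  · rintro ⟨S, hS⟩
    obtain ⟨l', hl', hs⟩ :=
      Knapsack.exists_sublist_of_mask (List.ofFn fun t : Fin (mOf l) => decide (t ∈ S)) (wts l)
    refine ⟨l', hl', ?_⟩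
    dsimp only
    rw [hs, maskSum_eq_sum _ _ (by simp), ← hS]
    conv_rhs => rw [← Finset.univ_inter S, ← Finset.sum_ite_mem]
    refine Finset.sum_congr rfl fun t _ => ?_
    have ht : (List.ofFn fun t : Fin (mOf l) => decide (t ∈ S)).getD t.1 false = decide (t ∈ S) := by
      simp [List.getD_eq_getElem?_getD, t.2]
    simp only [ht, decide_eq_true_eq]

/-- The `p`-indices: `t ↦ t`. [folklore] -/
private def pIdx (l : List ℕ) (t : Fin (mOf l)) : Fin (2 * mOf l + 2) := ⟨t.1, by omega⟩

/-- The `q`-indices: `t ↦ m + t`. [folklore] -/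
private def qIdx (l : List ℕ) (t : Fin (mOf l)) : Fin (2 * mOf l + 2) := ⟨mOf l + t.1, by omega⟩

/-- `pIdx` is injective. [folklore] -/
private theorem pIdx_injective (l : List ℕ) : Function.Injective (pIdx l) :=
  fun a b h => Fin.ext (by simpa [pIdx] using congrArg Fin.val h)

/-- `qIdx` is injective. [folklore] -/
private theorem qIdx_injective (l : List ℕ) : Function.Injective (qIdx l) :=
  fun a b h => Fin.ext (by have := congrArg Fin.val h; simp [qIdx] at this; omega)

/-- The point at a `p`-index. [folklore] -/
private theorem point_pIdx (l : List ℕ) (b : ℕ) (t : Fin (mOf l)) :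
    point l b (pIdx l t) = (wts l).getD t 0 * baseB l + 4 ^ (t : ℕ) :=
  (point_lt_of_lt b t.2).1

/-- The point at a `q`-index. [folklore] -/
private theorem point_qIdx (l : List ℕ) (b : ℕ) (t : Fin (mOf l)) : point l b (qIdx l t) = 4 ^ (t : ℕ) := by
  rw [qIdx, (point_mid b (by simp) (by simp; omega)).1]
  simp

/-- `Σ_{t<m} 4^t` over `Fin m`. [folklore] -/
private theorem sum_pow_four_fin (m : ℕ) : ∑ t : Fin m, 4 ^ (t : ℕ) = labelSum m := by
  rw [labelSum_eq, Fin.sum_univ_eq_sum_range]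

/-- **(→) An `m`-subset of the points with sum `c` gives a subset sum**: dummies are too large to
occur, and in base `B` the weight digits of the sum must equal `b`. [cite: BlaserIkenmeyerLysikovPandeySchreyer2019, Thm. 36 (proof)] -/
theorem exists_finset_of_subset_points {l : List ℕ} {b : ℕ} {R : Finset (Fin (2 * mOf l + 2))}
    (hsum : ∑ i ∈ R, point l b i.1 = target l b) :
    ∃ S : Finset (Fin (mOf l)), ∑ t ∈ S, (wts l).getD t.1 0 = b := by
  classical
  -- no dummies
  have hlow : ∀ i ∈ R, i.1 < 2 * mOf l := by
    intro i hi
    by_contra hge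
    have h1 : point l b i.1 ≤ ∑ j ∈ R, point l b j.1 :=
      Finset.single_le_sum (f := fun j : Fin (2 * mOf l + 2) => point l b j.1)
        (fun _ _ => Nat.zero_le _) hi
    rw [hsum, point_high b (not_lt.1 hge)] at h1
    have := target_lt_bigD l b
    omega
  -- split the sum in base `B`
  have hsplit : ∑ i ∈ R, point l b i.1 =
      baseB l * (∑ i ∈ R.filter (fun i : Fin (2 * mOf l + 2) => i.1 < mOf l), (wts l).getD i.1 0) +
        (∑ i ∈ R.filter (fun i : Fin (2 * mOf l + 2) => i.1 < mOf l), 4 ^ i.1 +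
          ∑ i ∈ R.filter (fun i : Fin (2 * mOf l + 2) => ¬ i.1 < mOf l), 4 ^ (i.1 - mOf l)) := by
    rw [← Finset.sum_filter_add_sum_filter_not R (fun i : Fin (2 * mOf l + 2) => i.1 < mOf l),
      Finset.mul_sum, ← add_assoc, ← Finset.sum_add_distrib]
    congr 1
    · refine Finset.sum_congr rfl fun i hi => ?_
      rw [(point_lt_of_lt b (Finset.mem_filter.1 hi).2).1]; ring
    · refine Finset.sum_congr rfl fun i hi => ?_
      obtain ⟨hiR, hin⟩ := Finset.mem_filter.1 hi
      exact (point_mid b (not_lt.1 hin) (hlow i hiR)).1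
  -- the label digits are `< B`
  have hL1 : ∑ i ∈ R.filter (fun i : Fin (2 * mOf l + 2) => i.1 < mOf l), 4 ^ i.1 ≤ labelSum (mOf l) := by
    calc ∑ i ∈ R.filter (fun i : Fin (2 * mOf l + 2) => i.1 < mOf l), 4 ^ i.1
        ≤ ∑ i ∈ (univ : Finset (Fin (mOf l))).image (pIdx l), 4 ^ i.1 :=
          Finset.sum_le_sum_of_subset_of_nonneg (fun i hi => ?_) (fun _ _ _ => Nat.zero_le _)
      _ = labelSum (mOf l) := by
          rw [Finset.sum_image fun a _ b _ h => pIdx_injective l h, ← sum_pow_four_fin]; rfl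
    obtain ⟨-, hin⟩ := Finset.mem_filter.1 hi
    exact Finset.mem_image.2 ⟨(⟨i.1, hin⟩ : Fin (mOf l)), Finset.mem_univ _, Fin.ext rfl⟩
  have hL2 : ∑ i ∈ R.filter (fun i : Fin (2 * mOf l + 2) => ¬ i.1 < mOf l), 4 ^ (i.1 - mOf l) ≤
      labelSum (mOf l) := by
    calc ∑ i ∈ R.filter (fun i : Fin (2 * mOf l + 2) => ¬ i.1 < mOf l), 4 ^ (i.1 - mOf l)
        ≤ ∑ i ∈ (univ : Finset (Fin (mOf l))).image (qIdx l), 4 ^ (i.1 - mOf l) :=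
          Finset.sum_le_sum_of_subset_of_nonneg (fun i hi => ?_) (fun _ _ _ => Nat.zero_le _)
      _ = labelSum (mOf l) := by
          rw [Finset.sum_image fun a _ b _ h => qIdx_injective l h, ← sum_pow_four_fin]
          exact Finset.sum_congr rfl fun t _ => by simp [qIdx]
    obtain ⟨hiR, hin⟩ := Finset.mem_filter.1 hi
    have h2 := hlow i hiR
    exact Finset.mem_image.2 ⟨(⟨i.1 - mOf l, by omega⟩ : Fin (mOf l)), Finset.mem_univ _,
      Fin.ext (by simp only [qIdx]; omega)⟩
  have hCB : labelSum (mOf l) < baseB l := by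
    have := two_mul_labelSum_lt (mOf l); rw [baseB]; omega
  have hLB : ∑ i ∈ R.filter (fun i : Fin (2 * mOf l + 2) => i.1 < mOf l), 4 ^ i.1 +
      ∑ i ∈ R.filter (fun i : Fin (2 * mOf l + 2) => ¬ i.1 < mOf l), 4 ^ (i.1 - mOf l) < baseB l := by
    have := two_mul_labelSum_lt (mOf l); rw [baseB]; omega
  -- compare the weight digits
  have hW : ∑ i ∈ R.filter (fun i : Fin (2 * mOf l + 2) => i.1 < mOf l), (wts l).getD i.1 0 = b := by
    have hB0 : 0 < baseB l := by rw [baseB]; positivity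
    have h1 : (baseB l * (∑ i ∈ R.filter (fun i : Fin (2 * mOf l + 2) => i.1 < mOf l), (wts l).getD i.1 0) +
        (∑ i ∈ R.filter (fun i : Fin (2 * mOf l + 2) => i.1 < mOf l), 4 ^ i.1 +
          ∑ i ∈ R.filter (fun i : Fin (2 * mOf l + 2) => ¬ i.1 < mOf l), 4 ^ (i.1 - mOf l))) / baseB l =
        (baseB l * b + labelSum (mOf l)) / baseB l := by
      rw [← hsplit, hsum, target, mul_comm]
    rw [Nat.mul_add_div hB0, Nat.mul_add_div hB0, Nat.div_eq_of_lt hLB, Nat.div_eq_of_lt hCB] at h1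
    simpa using h1
  -- read off the index set
  have himg : R.filter (fun i : Fin (2 * mOf l + 2) => i.1 < mOf l) =
      (univ.filter fun t : Fin (mOf l) => pIdx l t ∈ R).image (pIdx l) := by
    ext i
    simp only [Finset.mem_filter, Finset.mem_image, Finset.mem_univ, true_and]
    constructor
    · rintro ⟨hi, hin⟩
      have he : pIdx l ⟨i.1, hin⟩ = i := Fin.ext rfl
      exact ⟨⟨i.1, hin⟩, he.symm ▸ hi, he⟩
    · rintro ⟨t, ht, rfl⟩
      exact ⟨ht, t.2⟩
  rw [himg, Finset.sum_image fun a _ b _ h => pIdx_injective l h] at hW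
  exact ⟨_, hW⟩

/-- **(←) A subset sum gives an `m`-subset of the points with sum `c`**: take `p_t` for the chosen
weights and `q_t` for the others. [cite: BlaserIkenmeyerLysikovPandeySchreyer2019, Thm. 36 (proof)] -/
theorem exists_subset_points_of_finset {l : List ℕ} {b : ℕ} {S : Finset (Fin (mOf l))}
    (hS : ∑ t ∈ S, (wts l).getD t 0 = b) :
    ∃ R : Finset (Fin (2 * mOf l + 2)), R.card = mOf l ∧ ∑ i ∈ R, point l b i = target l b := by
  classical
  have hdisj : Disjoint (S.image (pIdx l)) (Sᶜ.image (qIdx l)) := by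
    rw [Finset.disjoint_left]
    rintro i hp hq
    obtain ⟨t, -, rfl⟩ := Finset.mem_image.1 hp
    obtain ⟨t', -, h⟩ := Finset.mem_image.1 hq
    have := congrArg Fin.val h
    simp [pIdx, qIdx] at this
    omega
  refine ⟨S.image (pIdx l) ∪ Sᶜ.image (qIdx l), ?_, ?_⟩
  · rw [Finset.card_union_of_disjoint hdisj, Finset.card_image_of_injective _ (pIdx_injective l),
      Finset.card_image_of_injective _ (qIdx_injective l), Finset.card_compl, Fintype.card_fin]
    have := Finset.card_le_univ S; rw [Fintype.card_fin] at this
    omega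
  · rw [Finset.sum_union hdisj, Finset.sum_image fun a _ b _ h => pIdx_injective l h,
      Finset.sum_image fun a _ b _ h => qIdx_injective l h]
    simp_rw [point_pIdx, point_qIdx]
    rw [Finset.sum_add_distrib, add_assoc, Finset.sum_add_sum_compl, ← Finset.sum_mul, hS,
      sum_pow_four_fin]
    rfl

end Digits

/-! ### §III. The pencil `Σ_a y_a · slice_a = diag(p_y(x_0), …, p_y(x_{2m+1}), τ(y))` -/

section Pencil

variable (F : Type u) [Field F]

/-- Items of a tabulated list. [folklore] -/
private theorem getD_map_range' (f : ℕ → ℤ) {m s : ℕ} (hs : s < m) : ((List.range m).map f).getD s 0 = f s := by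
  rw [List.getD_eq_getElem _ _ (by simpa using hs)]
  simp

/-- Row-major positions decode: `(a k + b) / k = a`, `(a k + b) mod k = b` for `b < k`. [folklore] -/
private theorem rowMajor_div_mod' {k a b : ℕ} (hb : b < k) : (a * k + b) / k = a ∧ (a * k + b) % k = b := by
  have hk : 0 < k := by omega
  constructor
  · rw [Nat.add_comm, Nat.add_mul_div_right _ _ hk, Nat.div_eq_of_lt hb, Nat.zero_add]
  · rw [Nat.add_comm, Nat.add_mul_mod_self_right, Nat.mod_eq_of_lt hb]

/-- Row-major positions are in range: `a k + b < m k` for `a < m`, `b < k`. [folklore] -/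
private theorem rowMajor_lt' {k m a b : ℕ} (ha : a < m) (hb : b < k) : a * k + b < m * k := by
  calc a * k + b < a * k + k := by omega
    _ = (a + 1) * k := by ring
    _ ≤ m * k := Nat.mul_le_mul_right _ ha

/-- Positions of the entry list decode. [folklore] -/
private theorem idx3 {N K : ℕ} (a : Fin K) (R C : Fin N) :
    a.1 * N ^ 2 + R.1 * N + C.1 < K * N ^ 2 ∧ (a.1 * N ^ 2 + R.1 * N + C.1) / N ^ 2 = a.1 ∧
      (a.1 * N ^ 2 + R.1 * N + C.1) / N % N = R.1 ∧ (a.1 * N ^ 2 + R.1 * N + C.1) % N = C.1 := by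
  set s := a.1 * N ^ 2 + R.1 * N + C.1 with hs
  have hs1 : s = (a.1 * N + R.1) * N + C.1 := by rw [hs]; ring
  have e1 : s / N = a.1 * N + R.1 ∧ s % N = C.1 := by rw [hs1]; exact rowMajor_div_mod' C.2
  have e2 : s / N ^ 2 = a.1 ∧ s / N % N = R.1 := by
    rw [sq, ← Nat.div_div_eq_div_mul, e1.1]; exact rowMajor_div_mod' R.2
  refine ⟨?_, e2.1, e2.2, e1.2⟩
  rw [hs1, sq, ← mul_assoc]
  exact rowMajor_lt' (rowMajor_lt' a.2 R.2) C.2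

/-- The entry list has the announced length `k N²`. [cite: BlaserIkenmeyerLysikovPandeySchreyer2019, Problem 2 (input)] -/
theorem length_entries36 (l : List ℕ) (b : ℕ) : (entries36 l b).length = (mOf l + 1) * dimN l ^ 2 := by
  simp [entries36]

/-- **The pencil of the instance is diagonal**: `Σ_a y_a slice_a = diag(Σ_a y_a d_a(R))_R`.
[cite: BlaserIkenmeyerLysikovPandeySchreyer2019, Thm. 36 (proof)] -/
theorem contract3_entries36 (l : List ℕ) (b : ℕ) (y : Fin (mOf l + 1) → F) :
    contract3 (hmrTensorOfList F (dimN l) (mOf l + 1) (entries36 l b)) y =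
      Matrix.diagonal fun R : Fin (dimN l) => ∑ a : Fin (mOf l + 1), y a * (diagEntry l b a R : F) := by
  ext R C
  simp only [contract3_apply, hmrTensorOfList, Matrix.diagonal_apply]
  have hT : ∀ a : Fin (mOf l + 1), (((entries36 l b).getD (a.1 * dimN l ^ 2 + R.1 * dimN l + C.1) 0 : ℤ) : F) =
      if R = C then (diagEntry l b a R : F) else 0 := by
    intro a
    obtain ⟨hs, e1, e2, e3⟩ := idx3 a R C
    rw [entries36, getD_map_range' _ hs, e1, e2, e3, sliceEntry36]
    by_cases h : R = C
    · simp [h]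
    · simp [h, Fin.val_ne_of_ne h]
  simp_rw [hT]
  split_ifs <;> simp

variable {F}

/-- The twist coefficients in `F`. [folklore] -/
private theorem cast_twist (l : List ℕ) (b a : ℕ) :
    ((twist l b a : ℤ) : F) = if a = mOf l then -(target l b : F) else if a + 1 = mOf l then -1 else 0 := by
  unfold twist
  by_cases h1 : a = mOf l
  · simp [h1]
  · by_cases h2 : a + 1 = mOf l
    · simp [h1, h2]
    · simp [h1, h2]

/-- Diagonal entry at a point position: the value `p_y(x_i)` of the generator polynomial.
[cite: BlaserIkenmeyerLysikovPandeySchreyer2019, Thm. 36 (proof: Vandermonde rows)] -/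
theorem diagVal_castSucc (l : List ℕ) (b : ℕ) (y : Fin (mOf l + 1) → F) (i : Fin (2 * mOf l + 2)) :
    ∑ a : Fin (mOf l + 1), y a * (diagEntry l b a (Fin.castSucc i : Fin (dimN l)) : F) =
      (∑ a : Fin (mOf l + 1), C (y a) * X ^ (a : ℕ)).eval (point l b i : F) := by
  rw [eval_sum_C_mul_X_pow]
  refine Finset.sum_congr rfl fun a _ => ?_
  rw [diagEntry, if_pos (by simp)]
  push_cast
  simp

/-- Diagonal entry at the last position: the twist `τ(y) = −c y_m − y_{m−1}` (as a sum).
[cite: BlaserIkenmeyerLysikovPandeySchreyer2019, Thm. 36 (proof: the bordered column)] -/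
theorem diagVal_last (l : List ℕ) (b : ℕ) (y : Fin (mOf l + 1) → F) :
    ∑ a : Fin (mOf l + 1), y a * (diagEntry l b a (Fin.last (2 * mOf l + 2) : Fin (dimN l)) : F) =
      ∑ a : Fin (mOf l + 1), y a *
        (if (a : ℕ) = mOf l then -(target l b : F) else if (a : ℕ) + 1 = mOf l then -1 else 0) := by
  refine Finset.sum_congr rfl fun a _ => ?_
  rw [diagEntry, if_neg (by simp), cast_twist]

/-- **The rank of the pencil is the weight of the twisted Reed–Solomon codeword**: the number of
non-roots of `p_y` among the points plus `[τ(y) ≠ 0]`.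
[cite: BlaserIkenmeyerLysikovPandeySchreyer2019, Thm. 36 (proof: "the rank of a linear combination of `B_i` is equal to the number of nonzero coordinates")] -/
theorem rank_contract3_entries36 [DecidableEq F] (l : List ℕ) (b : ℕ) (y : Fin (mOf l + 1) → F) :
    (contract3 (hmrTensorOfList F (dimN l) (mOf l + 1) (entries36 l b)) y).rank =
      (univ.filter fun i : Fin (2 * mOf l + 2) =>
          (∑ a : Fin (mOf l + 1), C (y a) * X ^ (a : ℕ)).eval (point l b i : F) ≠ 0).card +
        (if (∑ a : Fin (mOf l + 1), y a *
            (if (a : ℕ) = mOf l then -(target l b : F) else if (a : ℕ) + 1 = mOf l then -1 else 0)) = 0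
          then 0 else 1) := by
  rw [contract3_entries36, rank_diagonal_eq_card_filter, Finset.card_filter, Fin.sum_univ_castSucc,
    Finset.card_filter]
  congr 1
  · exact Finset.sum_congr rfl fun i _ => by rw [diagVal_castSucc]
  · rw [diagVal_last]
    simp only [ne_eq, ite_not]

/-- The typed target set of `hmrLanguageShape36`. [cite: BlaserIkenmeyerLysikovPandeySchreyer2019, Thm. 36] -/
def shape36Set (F : Type u) [Field F] : Set (ℕ × ℕ × List ℤ × ℕ) :=
  {x | HMRWellFormed x ∧ x.1 = 2 * x.2.1 + 1 ∧ x.2.2.2 = x.2.1 + 1 ∧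
    hmrTensorOfList F x.1 x.2.1 x.2.2.1 ∈ (minrankSet F x.2.2.2 : Set (Fin x.2.1 → Fin x.1 → Fin x.1 → F))}

variable (F)

/-- `hmrLanguageShape36` is the language of `shape36Set` (definitional). [cite: BlaserIkenmeyerLysikovPandeySchreyer2019, Thm. 36] -/
theorem hmrLanguageShape36_eq : hmrLanguageShape36 F = tensorInstEncoding.toLanguage (shape36Set F) := rfl

/-- The fixed output `bad36` is a no-instance (`0 ≠ 2·0 + 1`). [cite: BlaserIkenmeyerLysikovPandeySchreyer2019, Thm. 36] -/
theorem bad36_not_mem : bad36 ∉ shape36Set F := by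
  intro h
  rw [shape36Set, Set.mem_setOf_eq] at h
  obtain ⟨-, h1, -⟩ := h
  simp [bad36] at h1

/-- The points, cast into a field of characteristic `0`, stay pairwise distinct. [folklore] -/
private theorem cast_point_injective [CharZero F] (l : List ℕ) (b : ℕ) :
    Function.Injective fun i : Fin (2 * mOf l + 2) => (point l b i : F) := by
  intro i j h
  have h1 : (point l b i : F) = (point l b j : F) := h
  have h' : point l b i = point l b j := by exact_mod_cast h1
  exact Fin.ext (point_injOn l b i.2 j.2 h')

/-- **Correctness of the instance map**: `(l, b) ∈ SUBSET SUM ⟺ inst36 (l, b) ∈ HMinRank` (shape of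
Thm 36). (⇒) a solution gives an `m`-set of points with sum `c`, whose annihilating generator
combination has weight `m + 2` (`weight_of_subset`); (⇐) a combination of rank `≤ m + 2` has
exactly `m` roots among the points, summing to `c` (`exists_subset_of_weight_le`), and §II reads off
a solution. [cite: BlaserIkenmeyerLysikovPandeySchreyer2019, Thm. 36 (proof)] -/
theorem mem_knapsackSet_iff_inst36_mem [CharZero F] (x : List ℕ × ℕ) :
    x ∈ knapsackSet ↔ inst36 x ∈ shape36Set F := by
  classical
  obtain ⟨l, b⟩ := x
  have hwf : HMRWellFormed (inst36 (l, b)) := by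
    show (entries36 l b).length = (mOf l + 1) * dimN l ^ 2
    exact length_entries36 l b
  have hshape1 : (inst36 (l, b)).1 = 2 * (inst36 (l, b)).2.1 + 1 := by
    show 2 * mOf l + 2 + 1 = 2 * (mOf l + 1) + 1
    omega
  have hshape2 : (inst36 (l, b)).2.2.2 = (inst36 (l, b)).2.1 + 1 := by
    show mOf l + 2 = mOf l + 1 + 1
    omega
  have hcard : Fintype.card (Fin (2 * mOf l + 2)) = 2 * mOf l + 2 := Fintype.card_fin _
  have hinj := cast_point_injective (F := F) l b
  rw [mem_knapsackSet_iff_exists_finset, shape36Set, Set.mem_setOf_eq]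
  constructor
  · rintro ⟨S, hS⟩
    obtain ⟨R, hR, hsum⟩ := exists_subset_points_of_finset hS
    have hsumF : ∑ i ∈ R, (point l b i : F) = (target l b : F) := by exact_mod_cast hsum
    obtain ⟨y, hy, -, hcount, htw⟩ := weight_of_subset (fun i : Fin (2 * mOf l + 2) => (point l b i : F))
      hinj (target l b : F) R hR hsumF
    refine ⟨hwf, hshape1, hshape2, ?_⟩
    have hmem : hmrTensorOfList F (dimN l) (mOf l + 1) (entries36 l b) ∈ minrankSet F (mOf l + 2) := by
      rw [mem_minrankSet_iff]
      refine ⟨y, hy, ?_⟩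
      rw [rank_contract3_entries36, hcount, htw, if_pos rfl, hcard]
      omega
    exact hmem
  · rintro ⟨-, -, -, hmem⟩
    have hmem' : hmrTensorOfList F (dimN l) (mOf l + 1) (entries36 l b) ∈ minrankSet F (mOf l + 2) := hmem
    rw [mem_minrankSet_iff] at hmem'
    obtain ⟨y, hy, hrank⟩ := hmem'
    rw [rank_contract3_entries36] at hrank
    obtain ⟨R, -, -, hsum⟩ := exists_subset_of_weight_le (fun i : Fin (2 * mOf l + 2) => (point l b i : F))
      hinj hcard (target l b : F) y hy hrank
    have hsumN : ∑ i ∈ R, point l b i = target l b := by exact_mod_cast hsum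
    exact exists_finset_of_subset_points hsumN

end Pencil

/-! ### §IV. The machine: `inst36` is computed on codes in polynomial time -/

section Machine

/-- The code of a SUBSET SUM instance, in the `CodeFP` encoders. [cite: AroraBarak2009, §0.1] -/
def knapE : List ℕ × ℕ → List Bool := pairE (listE natE) natE

/-- `knapE` is `Knapsack.encodingK.encode`. [cite: AroraBarak2009, §0.1] -/
theorem knapE_eq : (Knapsack.encodingK.encode : List ℕ × ℕ → List Bool) = knapE := by
  unfold knapE
  rw [pairE_eq, listE_eq, natE_eq]

/-- The points with exponents capped by `m` (machine form; equal to `point`). [cite: AroraBarak2009, §1.3 (bounded loops)] -/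
def pointC (l : List ℕ) (b i : ℕ) : ℕ :=
  if decide (i < mOf l) then (wts l).getD i 0 * baseB l + 4 ^ min i (mOf l)
  else if decide (i < 2 * mOf l) then 4 ^ min (i - mOf l) (mOf l)
  else bigD l b + (i - 2 * mOf l) + 1

/-- The diagonal with the power capped by `m` (machine form; equal to `diagEntry` for `a ≤ m`).
[cite: AroraBarak2009, §1.3 (bounded loops)] -/
def diagEntryC (l : List ℕ) (b a R : ℕ) : ℤ :=
  if decide (R < 2 * mOf l + 2) then ((pointC l b R ^ min a (mOf l) : ℕ) : ℤ) else twist l b a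

/-- The entries with capped powers (machine form). [cite: AroraBarak2009, §1.3 (bounded loops)] -/
def sliceEntry36C (l : List ℕ) (b a R C : ℕ) : ℤ := if decide (R = C) then diagEntryC l b a R else 0

/-- The caps never bind on the points. [folklore] -/
private theorem pointC_eq (l : List ℕ) (b i : ℕ) : pointC l b i = point l b i := by
  unfold pointC point
  by_cases h1 : i < mOf l
  · simp [h1, min_eq_left h1.le]
  · by_cases h2 : i < 2 * mOf l
    · have : min (i - mOf l) (mOf l) = i - mOf l := min_eq_left (by omega)
      simp [h1, h2, this]
    · simp [h1, h2]

/-- The cap on the power does not bind for slices `a ≤ m`. [folklore] -/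
private theorem sliceEntry36C_eq (l : List ℕ) (b : ℕ) {a : ℕ} (ha : a ≤ mOf l) (R C : ℕ) :
    sliceEntry36C l b a R C = sliceEntry36 l b a R C := by
  simp only [sliceEntry36C, sliceEntry36, diagEntryC, diagEntry, pointC_eq, min_eq_left ha]

/-- The parameters `(m, B, c, D, w)` of an instance are computed on codes.
[cite: BlaserIkenmeyerLysikovPandeySchreyer2019, Thm. 36 (proof)] [cite: AroraBarak2009, §1.3] -/
theorem paramsFP : CodeFP knapE (pairE unE (pairE natE (pairE natE (pairE natE (rawE natE)))))
    (fun x => (mOf x.1, baseB x.1, target x.1 x.2, bigD x.1 x.2, wts x.1)) := by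
  have hl : CodeFP knapE (rawE natE) (fun x => x.1) := ((rawOfList natE).comp (fst _ _)).congr fun _ => rfl
  have hb : CodeFP knapE natE (fun x => x.2) := snd _ _
  have hp : CodeFP (pairE knapE natE) bitE (fun q => !decide (q.2 = 0)) :=
    (natEq.comp ((snd _ _).pair (const _ 0))).not.congr fun _ => rfl
  have hw : CodeFP knapE (rawE natE) (fun x => wts x.1) :=
    ((CodeFP.filter hp).comp ((CodeFP.id _).pair hl)).congr fun _ => rfl
  have hum : CodeFP knapE unE (fun x => mOf x.1) := (ulength natE).comp hw
  have hB : CodeFP knapE natE (fun x => baseB x.1) := (natPow.comp ((const _ 4).pair (unSucc.comp hum))).congr fun _ => rfl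
  -- `C = Σ_{t<m} 4^t`, the exponents in unary capped by `m`
  have hg : CodeFP (pairE knapE natE) natE (fun q => 4 ^ min q.2 (mOf q.1.1)) :=
    natPow.comp ((const _ 4).pair (unOfNatMin.comp ((hum.comp (fst _ _)).pair (snd _ _))))
  have hC : CodeFP knapE natE (fun x => labelSum (mOf x.1)) := by
    refine ((natSum.comp ((CodeFP.map hg).comp ((CodeFP.id _).pair (urange.comp hum)))).congr fun x => ?_)
    show ((List.range (mOf x.1)).map fun t => 4 ^ min t (mOf x.1)).sum = labelSum (mOf x.1)
    rw [labelSum, List.map_congr_left fun t ht => by rw [min_eq_left (List.mem_range.1 ht).le]]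
  have hc : CodeFP knapE natE (fun x => target x.1 x.2) := (natAdd.comp ((natMul.comp (hb.pair hB)).pair hC)).congr fun _ => rfl
  have hD : CodeFP knapE natE (fun x => bigD x.1 x.2) :=
    (natMul.comp (hB.pair (natAdd.comp ((natAdd.comp ((natSum.comp hw).pair hb)).pair (const _ 1))))).congr fun _ => rfl
  exact hum.pair (hB.pair (hc.pair (hD.pair hw)))

/-- The context of an entry: `((l, b), s)` — instance and position. [cite: AroraBarak2009, §1.3] -/
abbrev ctx36E : (List ℕ × ℕ) × ℕ → List Bool := pairE knapE natE

/-- **The entry table on codes** (`sliceEntry36C` at the decoded position).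
[cite: BlaserIkenmeyerLysikovPandeySchreyer2019, Thm. 36 (proof)] [cite: AroraBarak2009, §1.3] -/
theorem entry36FP : CodeFP ctx36E smE (fun c => sliceEntry36C c.1.1 c.1.2
    (c.2 / dimN c.1.1 ^ 2) (c.2 / dimN c.1.1 % dimN c.1.1) (c.2 % dimN c.1.1)) := by
  have hP := paramsFP.comp (fst knapE natE)
  have hum : CodeFP ctx36E unE (fun c => mOf c.1.1) := hP.fst'
  have hm : CodeFP ctx36E natE (fun c => mOf c.1.1) := natOfUn.comp hum
  have hB : CodeFP ctx36E natE (fun c => baseB c.1.1) := hP.snd'.fst'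
  have hc : CodeFP ctx36E natE (fun c => target c.1.1 c.1.2) := hP.snd'.snd'.fst'
  have hD : CodeFP ctx36E natE (fun c => bigD c.1.1 c.1.2) := hP.snd'.snd'.snd'.fst'
  have hw : CodeFP ctx36E (rawE natE) (fun c => wts c.1.1) := hP.snd'.snd'.snd'.snd'
  have hs : CodeFP ctx36E natE (fun c => c.2) := snd _ _
  have h2m : CodeFP ctx36E natE (fun c => 2 * mOf c.1.1) := natMul.comp ((const _ 2).pair hm)
  have h2m2 : CodeFP ctx36E natE (fun c => 2 * mOf c.1.1 + 2) := natAdd.comp (h2m.pair (const _ 2))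
  have hN : CodeFP ctx36E natE (fun c => dimN c.1.1) := (natAdd.comp (h2m2.pair (const _ 1))).congr fun _ => rfl
  have ha : CodeFP ctx36E natE (fun c => c.2 / dimN c.1.1 ^ 2) := natDiv.comp (hs.pair (natPow.comp (hN.pair (const _ 2))))
  have hR : CodeFP ctx36E natE (fun c => c.2 / dimN c.1.1 % dimN c.1.1) := natMod.comp ((natDiv.comp (hs.pair hN)).pair hN)
  have hCC : CodeFP ctx36E natE (fun c => c.2 % dimN c.1.1) := natMod.comp (hs.pair hN)
  -- the point at row `R`
  have hget : CodeFP ctx36E natE (fun c => (wts c.1.1).getD (c.2 / dimN c.1.1 % dimN c.1.1) 0) :=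
    (rawGetD natE natE_zero).comp (hw.pair hR)
  have hpow1 : CodeFP ctx36E natE (fun c => 4 ^ min (c.2 / dimN c.1.1 % dimN c.1.1) (mOf c.1.1)) :=
    natPow.comp ((const _ 4).pair (unOfNatMin.comp (hum.pair hR)))
  have hpow2 : CodeFP ctx36E natE (fun c => 4 ^ min (c.2 / dimN c.1.1 % dimN c.1.1 - mOf c.1.1) (mOf c.1.1)) :=
    natPow.comp ((const _ 4).pair (unOfNatMin.comp (hum.pair (natSub.comp (hR.pair hm)))))
  have hpt : CodeFP ctx36E natE (fun c => pointC c.1.1 c.1.2 (c.2 / dimN c.1.1 % dimN c.1.1)) :=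
    ((natLt.comp (hR.pair hm)).ite (natAdd.comp ((natMul.comp (hget.pair hB)).pair hpow1))
      ((natLt.comp (hR.pair h2m)).ite hpow2
        (natAdd.comp ((natAdd.comp (hD.pair (natSub.comp (hR.pair h2m)))).pair (const _ 1))))).congr
      fun _ => rfl
  -- the twist of slice `a`
  have htw : CodeFP ctx36E intE (fun c => twist c.1.1 c.1.2 (c.2 / dimN c.1.1 ^ 2)) :=
    ((natEq.comp (ha.pair hm)).ite (intNeg.comp (intOfNat.comp hc))
      ((natEq.comp ((natAdd.comp (ha.pair (const _ 1))).pair hm)).ite (const _ (-1 : ℤ))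
        (const _ (0 : ℤ)))).congr fun _ => rfl
  -- the diagonal entry and the entry
  have hdiag : CodeFP ctx36E intE (fun c => diagEntryC c.1.1 c.1.2 (c.2 / dimN c.1.1 ^ 2)
      (c.2 / dimN c.1.1 % dimN c.1.1)) :=
    ((natLt.comp (hR.pair h2m2)).ite
      (intOfNat.comp (natPow.comp (hpt.pair (unOfNatMin.comp (hum.pair ha))))) htw).congr fun _ => rfl
  exact (smOfInt.comp ((natEq.comp (hR.pair hCC)).ite hdiag (const _ (0 : ℤ)))).congr fun _ => rfl

/-- The unary loop budget `N³ = (2m+3)³ ≥ k N²`. [cite: AroraBarak2009, §1.3 (polynomially bounded loops)] -/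
theorem budget36FP : CodeFP knapE (rawE unitE) (fun x => List.replicate (dimN x.1 ^ 3) ()) := by
  have hum : CodeFP knapE unE (fun x => mOf x.1) := paramsFP.fst'
  refine ((unitsPow 3).comp (unSucc.comp (unSucc.comp (unSucc.comp (unAdd.comp (hum.pair hum)))))).congr
    fun x => ?_
  show List.replicate ((mOf x.1 + mOf x.1 + 1 + 1 + 1) ^ 3) () = List.replicate (dimN x.1 ^ 3) ()
  congr 2
  simp only [dimN]
  omega

/-- **The instance map `inst36` is computed on codes by a polynomial-time string function.**
[cite: BlaserIkenmeyerLysikovPandeySchreyer2019, Thm. 36] [cite: AroraBarak2009, §1.3] -/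
theorem inst36FP : CodeFP knapE BILPS19Thm34.instE inst36 := by
  have hm : CodeFP knapE natE (fun x => mOf x.1) := natOfUn.comp paramsFP.fst'
  have h2m2 : CodeFP knapE natE (fun x => 2 * mOf x.1 + 2) :=
    natAdd.comp ((natMul.comp ((const _ 2).pair hm)).pair (const _ 2))
  have hN : CodeFP knapE natE (fun x => dimN x.1) := (natAdd.comp (h2m2.pair (const _ 1))).congr fun _ => rfl
  have hk : CodeFP knapE natE (fun x => mOf x.1 + 1) := natAdd.comp (hm.pair (const _ 1))
  have hr : CodeFP knapE natE (fun x => mOf x.1 + 2) := natAdd.comp (hm.pair (const _ 2))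
  have hK : CodeFP knapE natE (fun x => (mOf x.1 + 1) * dimN x.1 ^ 2) :=
    natMul.comp (hk.pair (natPow.comp (hN.pair (const _ 2))))
  have hrange : CodeFP knapE (rawE natE)
      (fun x => List.range (min ((mOf x.1 + 1) * dimN x.1 ^ 2) (List.replicate (dimN x.1 ^ 3) ()).length)) :=
    (brange unitE).comp (budget36FP.pair hK)
  have hentries : CodeFP knapE (listE smE) (fun x => entries36 x.1 x.2) := by
    refine (((listOfRaw smE).comp ((CodeFP.map entry36FP).comp ((CodeFP.id _).pair hrange))).congr fun x => ?_)
    have hle : (mOf x.1 + 1) * dimN x.1 ^ 2 ≤ dimN x.1 ^ 3 := by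
      have : mOf x.1 + 1 ≤ dimN x.1 := by simp only [dimN]; omega
      calc (mOf x.1 + 1) * dimN x.1 ^ 2 ≤ dimN x.1 * dimN x.1 ^ 2 := Nat.mul_le_mul_right _ this
        _ = dimN x.1 ^ 3 := by ring
    show ((List.range (min ((mOf x.1 + 1) * dimN x.1 ^ 2) (List.replicate (dimN x.1 ^ 3) ()).length)).map
        fun s => sliceEntry36C x.1 x.2 (s / dimN x.1 ^ 2) (s / dimN x.1 % dimN x.1) (s % dimN x.1)) =
      entries36 x.1 x.2
    rw [List.length_replicate, min_eq_left hle, entries36]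
    refine List.map_congr_left fun s hs => sliceEntry36C_eq _ _ ?_ _ _
    rw [List.mem_range] at hs
    have hN : 0 < dimN x.1 ^ 2 := by positivity
    exact Nat.lt_succ_iff.1 ((Nat.div_lt_iff_lt_mul hN).2 hs)
  exact (hN.pair (hk.pair (hentries.pair hr))).congr fun _ => rfl

/-- The total decoder of KNAPSACK codes re-encodes in polynomial time. [cite: AroraBarak2009, §0.1] -/
theorem decK_codeFP : CodeFP strE Knapsack.encodingK.encode Knapsack.decK :=
  CodeFP.of_fn Knapsack.canonKFn Knapsack.canonKFn_mem_FP fun w => Knapsack.canonKFn_eq w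

end Machine

/-! ### §V. `KNAPSACK ≤ₚ HMinRank` (shape of Thm 36) -/

section Result

variable (F : Type u) [Field F] [CharZero F]

/-- **SUBSET SUM reduces to `HMinRank` for `n × (2n+1) × (2n+1)` tensors and `r = n + 1`**, over any
field of characteristic `0` (the twisted Reed–Solomon generator route of this file; module docstring).
[cite: BlaserIkenmeyerLysikovPandeySchreyer2019, Thm. 36] [cite: Karp1972, §3 problem 18] -/
theorem KNAPSACK_karpReducible_hmrLanguageShape36 : KNAPSACK ≤ₚ hmrLanguageShape36 F := by
  rw [hmrLanguageShape36_eq]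
  show Knapsack.encodingK.toLanguage knapsackSet ≤ₚ tensorInstEncoding.toLanguage (shape36Set F)
  refine BILPS19Thm34.karpReducible_of_decoder Knapsack.encodingK tensorInstEncoding (dec := Knapsack.decK)
    Knapsack.decK_encode decK_codeFP (g := inst36) ?_ (mem_knapsackSet_iff_inst36_mem F) (bad36_not_mem F)
  rw [BILPS19Thm34.instE_eq, knapE_eq]
  exact inst36FP

end Result

end BILPS19Thm36

section Discharge

variable (F : Type u) [Field F] [CharZero F]

/-- **Discharge of `BILPS2019_thm36`** (BILPS Thm 36: "Let `F` be a field of characteristic `0` and `K`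
be an effective subfield of `F`. Then `HMinRank_{K,F}` is NP-hard for `n × (2n+1) × (2n+1)` tensors
and `r = n + 1`", typed for `K = ℤ`-entries as `IsNPHard (hmrLanguageShape36 F)`): SUBSET SUM
(`KNAPSACK`, NP-hard by `KNAPSACK_isNPHard`) Karp-reduces to it
(`BILPS19Thm36.KNAPSACK_karpReducible_hmrLanguageShape36`). The reduction of this file is the
twisted Reed–Solomon GENERATOR pencil, not the printed Partition/kernel-basis map (module docstring);
the statement discharged is the vendored one, unchanged. [cite: BlaserIkenmeyerLysikovPandeySchreyer2019, Thm. 36] -/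
theorem BILPS2019_thm36_holds : BILPS2019_thm36 F :=
  IsHard.of_reducible_holds KNAPSACK_isNPHard (BILPS19Thm36.KNAPSACK_karpReducible_hmrLanguageShape36 F)

end Discharge

end Literature.Barriers.ValiantsHypothesis
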